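import Summits.NavierStokesRegularity.NavierStokesRegularity.Theorems.ScenarioCensusRowF1IntStretchZoom
import Summits.NavierStokesRegularity.NavierStokesRegularity.Theorems.ScenarioCensusRowF1FrozenTop
import HarnessLib

/-!
# LINE «integrated-stretch» port, part 3/5: §5 (b) THE TOOL — the space–time `lintegral` transfer through the singular zoom (`topIntegrand`, `integral_transfer₆`)

Re-homed for the scenario census (typer seat ns-census-typer-1 g8; the cells F1ip / F1ipb and the floors DP / DX are MEMBERS OF RECORD «DECIDED IN KERNEL IN FILES» of
row F1 since census v1.76 (critic idea-crit-3 g7 PASS — no price 01:59:32Z; ref ns-census-ref g10 PRE-CHECK ✓ §15.8–10; lead-presearch label); this port makes them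
TREE-decided): VERBATIM PORT of ns-idea-3 LINE 23 «integrated-stretch», `pub/ideators/ns-idea-3/lines/integrated-stretch/line-integrated-stretch.lean` sha16
1cd526fed4663244 (1567 l., lean check rc 0, 0 sorry), split for the 400-line rule into `ScenarioCensusRowF1IntStretch` (§1–§2) → `…IntStretchZoom` (§3–§5a) →
`…IntStretchTransfer` (§5b) → `…IntStretchKill` (§6–§7) → `…IntStretchBudget` (§8 + census KEYS).  Lean text VERBATIM in namespace
`…Theorems.ScenarioCensus.IntegratedStretch` (the line's `…Cruxes.ScenarioCensusRowF1.IntegratedStretchLine` re-homed); port edits: the bracket lines `section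
IntegralTransfer` / `end IntegralTransfer` dropped (no `variable`s; the section spans two parts), `@[conjecture]` on the residual `IpSlack` (≡ `ScenarioCensus.Row_F1`,
OPEN), four one-line docstrings added (gate lint); lemmas the line shares VERBATIM with the landed inviscid-top / frozen-top / columnar-top / stretched-top ports are
taken BY NAME (listed below).  Statements untouched.

No census VALUE is moved here (row F1 stays OPEN-WITH-LINE; the members become TREE-decided by name); NS regularity is NOT proved; `Row_F1` is untouched
(zero movement, `ipSlack_iff_rowF1`); no summit statement is proved by this file. Lemmas that restate already-landed tree declarations are taken BY NAME (gate lint `dedup.landed`): `fderiv_smul_stPull_apply` = `InviscidTop.fderiv_smul_stPull_apply`, `fderiv_smul_stPull` = `InviscidTop.fderiv_smul_stPull`, `fderiv_fderiv_smul_stPull` = `InviscidTop.fderiv_fderiv_smul_stPull`, `tendsto_clm_of_tendsto_apply` = `InviscidTop.tendsto_clm_of_tendsto_apply`, `tendsto_fderiv_fderiv_apply_of_bound` = `InviscidTop.tendsto_fderiv_fderiv_apply_of_bound`, `tendsto_fderiv_fderiv_of_bound` = `InviscidTop.tendsto_fderiv_fderiv_of_bound`, `tendsto_fderiv_fderiv_of_typeI_seq_Ioo`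 = `InviscidTop.tendsto_fderiv_fderiv_of_typeI_seq_Ioo`, `sing_of_not_bounded` = `InviscidTop.sing_of_not_bounded`, `convect_curl_self` = `FrozenTop.convect_curl_self`, `fderiv3_smul_stPull` = `FrozenTop.fderiv3_smul_stPull`, `tendsto_fderiv3_of_typeI_seq_Ioo` = `FrozenTop.tendsto_fderiv3_of_typeI_seq_Ioo`, `radius_eq` = `FrozenTop.radius_eq`, `jointCond_everywhere₆` = `FrozenTop.jointCond_everywhere₄`, `tendsto_physicalTime` = `ColumnarTop.tendsto_physicalTime`, `eventually_fast` = `ColumnarTop.eventually_fast`, `sqrt_timeLag` = `StretchedTop.sqrt_timeLag`, `forall_of_forall_ne_zero` = `StretchedTop.forall_of_forall_ne_zero`, `cert_ineq_of_stretching` = `StretchedTop.cert_ineq_of_stretching`, `typeI_ancient_eq_zero_of_subcriticalStretching` = `StretchedTop.typeI_ancient_eq_zero_of_subcriticalStretching`, `exists_singularZoom_package₃` = `FrozenTop.exists_singularZoom_package₃`, `lapD_eq_zero_of_eq_zero` = `FrozenTop.lapD_eq_zero_of_eq_zero`.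
-/

-- the summit and its single problem share the name `NavierStokesRegularity` (D-0017 nested layout)
set_option linter.dupNamespace false

noncomputable section

open MeasureTheory Set Function Filter TopologicalSpace Metric
open scoped Topology NNReal ENNReal InnerProductSpace RealInnerProductSpace Laplacian

namespace Summit.NavierStokesRegularity.NavierStokesRegularity.Theorems.ScenarioCensus.IntegratedStretch

open Literature.Analysis Literature.Analysis.FluidPDE
open Summit.NavierStokesRegularity.NavierStokesRegularity.Theorems

/-- The physical (ν-normalised, weighted, one-sided, top-restricted) space–time integrand of a read-out `Rd`. -/
def topIntegrand (T ν : ℝ) (Λ : ℝ → ℝ) (Rd : E3 → (E3 →L[ℝ] E3) → Hess → (E3 →L[ℝ] E3) → ℝ)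
    (u : ℝ → E3 → E3) : ℝ × E3 → ℝ≥0∞ :=
  {z : ℝ × E3 | z.1 ∈ Ico 0 T ∧ Λ z.1 < ‖u z.1 z.2‖}.indicator fun z =>
    ENNReal.ofReal (Real.sqrt (ν * (T - z.1)) *
      max 0 (Rd (ν⁻¹ • u z.1 z.2) (ν⁻¹ • fderiv ℝ (u z.1) z.2) (ν⁻¹ • fderiv ℝ (fderiv ℝ (u z.1)) z.2)
        (ν⁻¹ • lapD (u z.1) z.2)))

/-- The top set `{(t, x) : 0 ≤ t < T, Λ t < |u(t, x)|}` of a classical solution is measurable when the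
level `Λ` is measurable. -/
theorem measurableSet_top {ν T : ℝ} {u : ℝ → E3 → E3} {p : ℝ → E3 → ℝ}
    (hsol : IsClassicalNSSolutionOn (Ico 0 T) ν 0 u p) {Λ : ℝ → ℝ} (hΛm : Measurable Λ) :
    MeasurableSet {z : ℝ × E3 | z.1 ∈ Ico 0 T ∧ Λ z.1 < ‖u z.1 z.2‖} := by
  classical
  set slab : Set (ℝ × E3) := Ico 0 T ×ˢ univ with hslab
  have hslabm : MeasurableSet slab := measurableSet_Ico.prod MeasurableSet.univ
  have hutm : Measurable (slab.piecewise (uncurry u) (fun _ => (0 : E3))) :=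
    ContinuousOn.measurable_piecewise hsol.smooth_velocity.continuousOn continuousOn_const hslabm
  have hset : {z : ℝ × E3 | z.1 ∈ Ico 0 T ∧ Λ z.1 < ‖u z.1 z.2‖} =
      slab ∩ {z | Λ z.1 < ‖slab.piecewise (uncurry u) (fun _ => (0 : E3)) z‖} := by
    ext z
    constructor
    · rintro ⟨h1, h2⟩
      have hz : z ∈ slab := ⟨h1, mem_univ _⟩
      refine ⟨hz, ?_⟩
      show Λ z.1 < ‖slab.piecewise (uncurry u) (fun _ => (0 : E3)) z‖
      rw [piecewise_eq_of_mem _ _ _ hz]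
      exact h2
    · rintro ⟨hz, h2⟩
      refine ⟨hz.1, ?_⟩
      have h2' : Λ z.1 < ‖slab.piecewise (uncurry u) (fun _ => (0 : E3)) z‖ := h2
      rw [piecewise_eq_of_mem _ _ _ hz] at h2'
      exact h2'
  rw [hset]
  exact hslabm.inter (measurableSet_lt (hΛm.comp measurable_fst) hutm.norm)

/-- Continuity of the `ν`-normalised one-sided read-out on quadruples. -/
theorem continuous_maxRdnu (ν : ℝ) {Rd : E3 → (E3 →L[ℝ] E3) → Hess → (E3 →L[ℝ] E3) → ℝ}
    (hRc : Continuous fun q : E3 × (E3 →L[ℝ] E3) × Hess × (E3 →L[ℝ] E3) => Rd q.1 q.2.1 q.2.2.1 q.2.2.2) :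
    Continuous fun q : E3 × (E3 →L[ℝ] E3) × Hess × (E3 →L[ℝ] E3) =>
      max 0 (Rd (ν⁻¹ • q.1) (ν⁻¹ • q.2.1) (ν⁻¹ • q.2.2.1) (ν⁻¹ • q.2.2.2)) := by
  have hsc : Continuous fun q : E3 × (E3 →L[ℝ] E3) × Hess × (E3 →L[ℝ] E3) =>
      (ν⁻¹ • q.1, ν⁻¹ • q.2.1, ν⁻¹ • q.2.2.1, ν⁻¹ • q.2.2.2) := by fun_prop
  exact continuous_const.max (hRc.comp hsc)

/-- The top integrand of a classical solution (measurable level, continuous read-out) is a.e.-measurable. -/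
theorem aemeasurable_topIntegrand {ν T : ℝ} {u : ℝ → E3 → E3} {p : ℝ → E3 → ℝ}
    (hsol : IsClassicalNSSolutionOn (Ico 0 T) ν 0 u p)
    {Rd : E3 → (E3 →L[ℝ] E3) → Hess → (E3 →L[ℝ] E3) → ℝ}
    (hRc : Continuous fun q : E3 × (E3 →L[ℝ] E3) × Hess × (E3 →L[ℝ] E3) => Rd q.1 q.2.1 q.2.2.1 q.2.2.2)
    {Λ : ℝ → ℝ} (hΛm : Measurable Λ) : AEMeasurable (topIntegrand T ν Λ Rd u) volume := by
  have hS' := measurableSet_top hsol hΛm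
  unfold topIntegrand
  refine (aemeasurable_indicator_iff hS').2 ?_
  have hsub : {z : ℝ × E3 | z.1 ∈ Ico 0 T ∧ Λ z.1 < ‖u z.1 z.2‖} ⊆ Ico 0 T ×ˢ univ :=
    fun z hz => ⟨hz.1, mem_univ _⟩
  refine (ContinuousOn.mono ?_ hsub).aemeasurable hS'
  have hq := continuousOn_quad (uniqueDiffOn_Ico 0 T) hsol.smooth_velocity
  have hG1 : ContinuousOn (fun z : ℝ × E3 =>
      max 0 (Rd (ν⁻¹ • u z.1 z.2) (ν⁻¹ • fderiv ℝ (u z.1) z.2) (ν⁻¹ • fderiv ℝ (fderiv ℝ (u z.1)) z.2)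
        (ν⁻¹ • lapD (u z.1) z.2))) (Ico 0 T ×ˢ univ) :=
    (continuous_maxRdnu ν hRc).comp_continuousOn hq
  have hw : ContinuousOn (fun z : ℝ × E3 => Real.sqrt (ν * (T - z.1))) (Ico 0 T ×ˢ univ) :=
    (Real.continuous_sqrt.comp (continuous_const.mul (continuous_const.sub continuous_fst))).continuousOn
  exact ENNReal.continuous_ofReal.comp_continuousOn (hw.mul hG1)

/-- **INTEGRAL TRANSFER (weight 6, one-sided).**  If the top-restricted, `(ν(T−t))^{1/2}`-weighted space–time
integral of `max 0 Rd(u/ν, ∇u/ν, ∇²u/ν, K/ν)` over `[0, T) × ℝ³` is FINITE (subcritical MEASURABLE level), then the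
zoom limit satisfies `Rd(W, ∇W, ∇²W, Σ D³W eᵢeᵢ) ≤ 0` at every point of the open past where `W ≠ 0`.
Proof: box `K` where the limit read-out exceeds `δ > 0` (joint continuity on the classical windows of `𝒦`);
`∫_K (c_j R)⁵ F∘Φ_j = ν ∫_{Φ_j K} F → 0` (scale invariance + absolute continuity, `vol(Φ_j K) = c_j⁵ β R³ vol K → 0`);
Fatou; but pointwise on `K` the integrand is eventually `√(−t) · max 0 Rd(zoom_j) ≥ √(−s₀/2) δ` (fast, in the slab,
read-out convergence) — contradiction. -/
theorem integral_transfer₆ {T ν M : ℝ} {u : ℝ → E3 → E3} {p : ℝ → E3 → ℝ} {x₀ : E3} {α β R : ℝ} {c : ℕ → ℝ}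
    {W : ℝ → E3 → E3} (hν : 0 < ν) (hT : 0 < T) (hsol : IsClassicalNSSolutionOn (Ico 0 T) ν 0 u p)
    (hW : IsTypeIAncientMild M W)
    (hα : 0 < α) (hβ : 0 < β) (hαR : α * R = β) (hαν : α * Real.sqrt ν = Real.sqrt β)
    (hcpos : ∀ j, 0 < c j) (hclim : Tendsto c atTop (𝓝 0))
    (hpt : ∀ t < 0, ∀ y : E3,
      Tendsto (fun j => (c j * α) • u (T + c j ^ 2 * β * t) (x₀ + (c j * R) • y)) atTop (𝓝 (W t y)))
    (hgrad : ∀ t < 0, ∀ y : E3,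
      Tendsto (fun j => (c j * α * (c j * R)) • fderiv ℝ (u (T + c j ^ 2 * β * t)) (x₀ + (c j * R) • y))
        atTop (𝓝 (fderiv ℝ (W t) y)))
    (hhess : ∀ t < 0, ∀ y : E3,
      Tendsto (fun j => (c j * α * (c j * R) * (c j * R)) •
          fderiv ℝ (fderiv ℝ (u (T + c j ^ 2 * β * t))) (x₀ + (c j * R) • y))
        atTop (𝓝 (fderiv ℝ (fderiv ℝ (W t)) y)))
    (hlap : ∀ t < 0, ∀ y : E3,
      Tendsto (fun j => (c j * α * (c j * R) * (c j * R) * (c j * R)) •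
          lapD (u (T + c j ^ 2 * β * t)) (x₀ + (c j * R) • y))
        atTop (𝓝 (lapD (W t) y)))
    {Rd : E3 → (E3 →L[ℝ] E3) → Hess → (E3 →L[ℝ] E3) → ℝ}
    (hRc : Continuous fun q : E3 × (E3 →L[ℝ] E3) × Hess × (E3 →L[ℝ] E3) => Rd q.1 q.2.1 q.2.2.1 q.2.2.2)
    (hRh : ∀ a : ℝ, 0 < a → ∀ v L H K, Rd (a • v) (a ^ 2 • L) (a ^ 3 • H) (a ^ 4 • K) = a ^ 6 * Rd v L H K)
    {Λ : ℝ → ℝ} (hΛ : IsSubcriticalLevel T Λ) (hΛm : Measurable Λ)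
    (hfin : ∫⁻ z, topIntegrand T ν Λ Rd u z < ⊤) :
    ∀ s < 0, ∀ y, W s y ≠ 0 →
      Rd (W s y) (fderiv ℝ (W s) y) (fderiv ℝ (fderiv ℝ (W s)) y) (lapD (W s) y) ≤ 0 := by
  intro s₀ hs₀ y₀ hne
  by_contra hcon
  rw [not_le] at hcon
  set F := topIntegrand T ν Λ Rd u with hF
  -- the limit read-out as a space–time function
  obtain ⟨QW, hQW⟩ : ∃ QW : ℝ × E3 → E3 × (E3 →L[ℝ] E3) × Hess × (E3 →L[ℝ] E3), ∀ z,
      QW z = (W z.1 z.2, fderiv ℝ (W z.1) z.2, fderiv ℝ (fderiv ℝ (W z.1)) z.2, lapD (W z.1) z.2) :=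
    ⟨_, fun _ => rfl⟩
  obtain ⟨RdW, hRdW⟩ : ∃ RdW : ℝ × E3 → ℝ, ∀ z, RdW z = Rd (QW z).1 (QW z).2.1 (QW z).2.2.1 (QW z).2.2.2 :=
    ⟨_, fun _ => rfl⟩
  have hRdW0 : 0 < RdW (s₀, y₀) := by rw [hRdW, hQW]; exact hcon
  -- ### (A) a box `K` around `(s₀, y₀)` on which `RdW > δ`, `W ≠ 0`, `t < s₀ / 2 < 0`
  obtain ⟨q, hcl⟩ := hW.exists_isClassicalNSSolutionOn_Ioo (t₀ := s₀ - 1) (by linarith)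
  have hslab : Ioo (s₀ - 1) 0 ×ˢ (univ : Set E3) ∈ 𝓝 (s₀, y₀) :=
    (isOpen_Ioo.prod isOpen_univ).mem_nhds ⟨⟨by linarith, hs₀⟩, mem_univ _⟩
  have hQc : ContinuousAt QW (s₀, y₀) := by
    have h := (continuousOn_quad (uniqueDiffOn_Ioo (s₀ - 1) 0) hcl.smooth_velocity).continuousAt hslab
    refine (continuousAt_congr (Eventually.of_forall fun z => hQW z)).2 h
  have hRdc : ContinuousAt RdW (s₀, y₀) := by
    have h := hRc.continuousAt.comp hQc
    exact (continuousAt_congr (Eventually.of_forall fun z => hRdW z)).2 h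
  have hWc : ContinuousAt (uncurry W) (s₀, y₀) := hcl.smooth_velocity.continuousOn.continuousAt hslab
  set δ : ℝ := RdW (s₀, y₀) / 2 with hδ
  have hδpos : 0 < δ := by positivity
  have ev1 : ∀ᶠ z in 𝓝 (s₀, y₀), δ < RdW z :=
    hRdc.eventually (lt_mem_nhds (show δ < RdW (s₀, y₀) by linarith))
  have ev2 : ∀ᶠ z in 𝓝 (s₀, y₀), uncurry W z ≠ 0 :=
    hWc.eventually (isOpen_compl_singleton.mem_nhds hne)
  have ev3 : ∀ᶠ z : ℝ × E3 in 𝓝 (s₀, y₀), z.1 < s₀ / 2 :=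
    (continuous_fst.tendsto (s₀, y₀)).eventually (gt_mem_nhds (show s₀ < s₀ / 2 by linarith))
  obtain ⟨r, hr, hball⟩ := Metric.eventually_nhds_iff_ball.1 (ev1.and (ev2.and ev3))
  set ρ : ℝ := r / 2 with hρ
  have hρpos : 0 < ρ := by positivity
  set K : Set (ℝ × E3) := Icc (s₀ - ρ) (s₀ + ρ) ×ˢ closedBall y₀ ρ with hK
  have hKball : K ⊆ ball (s₀, y₀) r := by
    intro z hz
    rw [mem_ball, Prod.dist_eq, max_lt_iff]
    refine ⟨?_, lt_of_le_of_lt (mem_closedBall.1 hz.2) (by linarith)⟩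
    rw [Real.dist_eq, abs_lt]
    constructor <;> linarith [hz.1.1, hz.1.2]
  have hKprop : ∀ z ∈ K, δ < RdW z ∧ uncurry W z ≠ 0 ∧ z.1 < s₀ / 2 := fun z hz => hball z (hKball hz)
  have hKm : MeasurableSet K := measurableSet_Icc.prod isClosed_closedBall.measurableSet
  have hKvol : volume K = ENNReal.ofReal (s₀ + ρ - (s₀ - ρ)) * volume (closedBall y₀ ρ) := by
    rw [hK, Measure.volume_eq_prod ℝ E3, Measure.prod_prod, Real.volume_Icc]
  have hKpos : volume K ≠ 0 := by
    rw [hKvol]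
    exact (ENNReal.mul_pos (ENNReal.ofReal_pos.2 (by linarith)).ne'
      (measure_closedBall_pos volume y₀ hρpos).ne').ne'
  have hKtop : volume K ≠ ⊤ := by
    rw [hKvol]
    exact ENNReal.mul_ne_top ENNReal.ofReal_ne_top measure_closedBall_lt_top.ne
  -- ### (B) the zoom charts `Φ_j`; `ν ∫_{Φ_j K} F = ∫_K (c_j R)⁵ F∘Φ_j → 0`
  have hR := FrozenTop.radius_eq hν hα hβ hαR hαν
  have hRpos : 0 < R := by rw [hR]; positivity
  have ha : ∀ j, 0 < c j ^ 2 * β := fun j => mul_pos (pow_pos (hcpos j) 2) hβ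
  have hb : ∀ j, 0 < c j * R := fun j => mul_pos (hcpos j) hRpos
  obtain ⟨Φ, hΦ⟩ : ∃ Φ : ℕ → ℝ × E3 ≃ᵐ ℝ × E3,
      ∀ j, Φ j = zoomChart T (c j ^ 2 * β) x₀ (c j * R) (ha j).ne' (hb j).ne' := ⟨_, fun _ => rfl⟩
  have hΦapply : ∀ j (z : ℝ × E3), Φ j z = (T + c j ^ 2 * β * z.1, x₀ + (c j * R) • z.2) := by
    intro j z; rw [hΦ j]; rfl
  have hvolK : Tendsto (fun j => volume (Φ j '' K)) atTop (𝓝 0) := by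
    have h1 : ∀ j, volume (Φ j '' K) = ENNReal.ofReal (c j ^ 2 * β * (c j * R) ^ 3) * volume K := by
      intro j; rw [hΦ j]; exact volume_image_zoomChart (ha j) (hb j) K
    simp_rw [h1]
    have h2 : Tendsto (fun j => c j ^ 2 * β * (c j * R) ^ 3) atTop (𝓝 0) := by
      have := ((hclim.pow 2).mul_const β).mul ((hclim.mul_const R).pow 3)
      simpa using this
    have h3 := (ENNReal.continuous_ofReal.tendsto 0).comp h2
    rw [ENNReal.ofReal_zero] at h3
    have h4 := ENNReal.Tendsto.mul_const h3 (Or.inr hKtop)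
    rwa [zero_mul] at h4
  have hIK : Tendsto (fun j => ∫⁻ z in Φ j '' K, F z) atTop (𝓝 0) :=
    tendsto_setLIntegral_zero hfin.ne hvolK
  have hgK : ∀ j, ∫⁻ z in K, ENNReal.ofReal ((c j * R) ^ 5) * F (Φ j z) =
      ENNReal.ofReal ν * ∫⁻ z in Φ j '' K, F z := by
    intro j
    rw [lintegral_const_mul' _ _ ENNReal.ofReal_ne_top, hΦ j,
      setLIntegral_comp_zoomChart (ha j) (hb j) F K, ← mul_assoc,
      ← ENNReal.ofReal_mul (pow_nonneg (hb j).le 5)]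
    congr 2
    have hβ' : β = ν * α ^ 2 := by rw [← hαR, hR]; ring
    have hcj : c j ≠ 0 := (hcpos j).ne'
    rw [hR, hβ']
    field_simp
  have hgK0 : Tendsto (fun j => ∫⁻ z in K, ENNReal.ofReal ((c j * R) ^ 5) * F (Φ j z)) atTop (𝓝 0) := by
    simp_rw [hgK]
    have h := ENNReal.Tendsto.const_mul hIK (Or.inr ENNReal.ofReal_ne_top) (a := ENNReal.ofReal ν)
    rwa [mul_zero] at h
  -- ### (C) Fatou on `K`
  have hFm : AEMeasurable F volume := aemeasurable_topIntegrand hsol hRc hΛm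
  have hgm : ∀ j, AEMeasurable (fun z => ENNReal.ofReal ((c j * R) ^ 5) * F (Φ j z)) (volume.restrict K) := by
    intro j
    have h := aemeasurable_comp_zoomChart (T := T) (x₀ := x₀) (ha j) (hb j) hFm
    rw [← hΦ j] at h
    exact (h.const_mul _).restrict
  have hfatou : ∫⁻ z in K, liminf (fun j => ENNReal.ofReal ((c j * R) ^ 5) * F (Φ j z)) atTop = 0 := by
    have h := lintegral_liminf_le' (μ := volume.restrict K) (u := atTop) hgm
    rw [hgK0.liminf_eq] at h
    exact le_antisymm h bot_le
  -- ### (D) pointwise on `K`: `liminf_j ≥ κ > 0`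
  set κ : ℝ := Real.sqrt (-(s₀ / 2)) * δ with hκ
  have hκpos : 0 < κ := mul_pos (Real.sqrt_pos.2 (by linarith)) hδpos
  have hlow : ∀ z ∈ K, ENNReal.ofReal κ ≤
      liminf (fun j => ENNReal.ofReal ((c j * R) ^ 5) * F (Φ j z)) atTop := by
    intro z hz
    obtain ⟨hz1, hz2, hz3⟩ := hKprop z hz
    have ht : z.1 < 0 := by linarith
    have hneW : W z.1 z.2 ≠ 0 := hz2
    have hfast := ColumnarTop.eventually_fast hα hβ hcpos hclim hpt hΛ ht hneW
    have hτ := (ColumnarTop.tendsto_physicalTime (T := T) hβ ht hcpos hclim).eventually (Ioo_mem_nhdsLT hT)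
    have hj := (hpt z.1 ht z.2).prodMk_nhds ((hgrad z.1 ht z.2).prodMk_nhds
      ((hhess z.1 ht z.2).prodMk_nhds (hlap z.1 ht z.2)))
    have hlim := (hRc.tendsto _).comp hj
    have hz1' : δ < Rd (W z.1 z.2) (fderiv ℝ (W z.1) z.2) (fderiv ℝ (fderiv ℝ (W z.1)) z.2) (lapD (W z.1) z.2) := by
      have h := hz1; rw [hRdW, hQW] at h; exact h
    have hRd := hlim.eventually (lt_mem_nhds hz1')
    refine le_liminf_of_le (h := ?_)
    filter_upwards [hfast, hτ, hRd] with j hj1 hj2 hj3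
    have hb' := hb j
    have hmem : Φ j z ∈ {z' : ℝ × E3 | z'.1 ∈ Ico 0 T ∧ Λ z'.1 < ‖u z'.1 z'.2‖} := by
      rw [hΦapply]
      exact ⟨Ioo_subset_Ico_self hj2, hj1⟩
    -- the value of the integrand at such `j`
    have e1 : c j * α = (c j * R) * ν⁻¹ := by rw [hR]; field_simp
    have e2 : c j * α * (c j * R) = (c j * R) ^ 2 * ν⁻¹ := by rw [hR]; field_simp
    have e3 : c j * α * (c j * R) * (c j * R) = (c j * R) ^ 3 * ν⁻¹ := by rw [hR]; field_simp
    have e4 : c j * α * (c j * R) * (c j * R) * (c j * R) = (c j * R) ^ 4 * ν⁻¹ := by rw [hR]; field_simp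
    have hj3' : δ < Rd ((c j * α) • u (T + c j ^ 2 * β * z.1) (x₀ + (c j * R) • z.2))
        ((c j * α * (c j * R)) • fderiv ℝ (u (T + c j ^ 2 * β * z.1)) (x₀ + (c j * R) • z.2))
        ((c j * α * (c j * R) * (c j * R)) •
          fderiv ℝ (fderiv ℝ (u (T + c j ^ 2 * β * z.1))) (x₀ + (c j * R) • z.2))
        ((c j * α * (c j * R) * (c j * R) * (c j * R)) •
          lapD (u (T + c j ^ 2 * β * z.1)) (x₀ + (c j * R) • z.2)) := hj3
    rw [e4, e3, e2, e1, mul_smul (c j * R) ν⁻¹, mul_smul ((c j * R) ^ 2) ν⁻¹, mul_smul ((c j * R) ^ 3) ν⁻¹,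
      mul_smul ((c j * R) ^ 4) ν⁻¹, hRh _ hb'] at hj3'
    -- hj3 : δ < (c j * R) ^ 6 * Rd (ν⁻¹ • u …) (ν⁻¹ • ∇u …) (ν⁻¹ • ∇²u …) (ν⁻¹ • K …)
    rw [hF, topIntegrand, indicator_of_mem hmem, hΦapply]
    simp only
    rw [← ENNReal.ofReal_mul (pow_nonneg hb'.le 5), sqrt_nu_timeLag (T := T) (t := z.1) hν hα hβ hαR hαν hcpos j]
    refine ENNReal.ofReal_le_ofReal ?_
    have hsq : Real.sqrt (-(s₀ / 2)) ≤ Real.sqrt (-z.1) := Real.sqrt_le_sqrt (by linarith)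
    have h6 : (0 : ℝ) < (c j * R) ^ 6 := pow_pos hb' 6
    set m := Rd (ν⁻¹ • u (T + c j ^ 2 * β * z.1) (x₀ + (c j * R) • z.2))
        (ν⁻¹ • fderiv ℝ (u (T + c j ^ 2 * β * z.1)) (x₀ + (c j * R) • z.2))
        (ν⁻¹ • fderiv ℝ (fderiv ℝ (u (T + c j ^ 2 * β * z.1))) (x₀ + (c j * R) • z.2))
        (ν⁻¹ • lapD (u (T + c j ^ 2 * β * z.1)) (x₀ + (c j * R) • z.2)) with hm
    have hm6 : δ < (c j * R) ^ 6 * m := hj3'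
    have hmax : δ ≤ (c j * R) ^ 6 * max 0 m :=
      hm6.le.trans (mul_le_mul_of_nonneg_left (le_max_right _ _) h6.le)
    calc κ = Real.sqrt (-(s₀ / 2)) * δ := rfl
      _ ≤ Real.sqrt (-z.1) * δ := mul_le_mul_of_nonneg_right hsq hδpos.le
      _ ≤ Real.sqrt (-z.1) * ((c j * R) ^ 6 * max 0 m) :=
          mul_le_mul_of_nonneg_left hmax (Real.sqrt_nonneg _)
      _ = (c j * R) ^ 5 * (c j * R * Real.sqrt (-z.1) * max 0 m) := by ring
  -- ### (E) contradiction: `0 = ∫_K liminf ≥ κ · vol K > 0`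
  have hge : ∫⁻ _ in K, ENNReal.ofReal κ ≤
      ∫⁻ z in K, liminf (fun j => ENNReal.ofReal ((c j * R) ^ 5) * F (Φ j z)) atTop :=
    setLIntegral_mono' hKm fun z hz => hlow z hz
  rw [setLIntegral_const, hfatou] at hge
  exact (mul_ne_zero (ENNReal.ofReal_pos.2 hκpos).ne' hKpos) (le_antisymm hge bot_le)

end Summit.NavierStokesRegularity.NavierStokesRegularity.Theorems.ScenarioCensus.IntegratedStretch

end
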